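/-
COR-CM (cell pub-hodgecm2, stage 2 of the Hodge ladder) — count-neutral KERNEL COMBINATORICS «the odd-slice dictionary» (seat
prover-pub-hodgecm2-b23-g36-0, binder prover b23, gen 36; claim ODD-SLICE-TRANSPORT F1, HOME/INBOX.md 2026-08-22T05:31:42Z;
sequel of the INT2-TRANSPORT files `CorCM/FaceCensusDictionary.lean`, `CorCM/FaceCensusCells.lean` … `CorCM/FaceCensusOrbitTransversal.lean`).  Bookkeeping
definitions (`typeMap`, `typeOf`, `typeEquiv`) and dictionary lemmas; no geometry beyond the tree's `Face`, no
`Universe`, no named fact, nothing asserted.  Seat b09's representative-free model of the faithful full odd slice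
(`Census/OddSliceFacesModel.lean` p318768, `Census/OddSliceFacesSquares.lean` p319130: `Ty`, `tw`, `transl`, `δ`, `pairVec`,
`faceVec`) is used BY NAME; nothing of theirs is restated or re-filed; `Interfaces.lean` (C1), every E term, B01 and
`Transposition/*` are untouched.
HONEST FRAMING (COORDINATOR RULING — HODGE FRAMING CORRECTION, 2026-08-21T11:55:35Z): `HC_CM` is NOT proved, here or anywhere in
the tree; this file proves no face period and no generation statement for any particular field.
-/
import Summits.HodgeConjecture.CorCM.FaceCensusCells
import Summits.HodgeConjecture.CorCM.Census.OddSliceFacesSquares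
import HarnessLib

/-!
# The odd-slice dictionary: abstract CM types of a Galois CM field with group `ℤ/2 × A` read as maps `A → ℤ/2`

For a Galois CM field `F` whose group `E = GalT F` of Galois translates (with complex conjugation `conjT`,
`CorCM/CM/LefschetzChar1.lean`) is identified with `ℤ/2 × A` — the DICTIONARY DATUM is a bijection

  `θ : GalT F ≃ ZMod 2 × A` with `θ (P * Q) = θ P + θ Q` and `θ conjT = (1, 0)`

(every Galois CM field of degree `≡ 2 (mod 4)` with abelian Galois group has one: `A` = the odd part) — the abstract CM types
`CMF (GalT F) conjT` ARE the labels `Ty A = A → ZMod 2` of seat b09's representative-free model of the faithful full slice of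
`(ℤ/2 × A, (1,0))` (`Census/OddSliceFacesModel.lean`): `Ψ ↦ typeMap θ Ψ = (y ↦ 0 if θ⁻¹(0, y) ∈ Ψ, else 1)`, i.e. `Ψ` is the graph
`{(φ y, y)}` of `φ = typeMap θ Ψ` (`mem_iff_typeMap`), with inverse `typeOf` (`typeEquiv`).  Under this dictionary (all [folklore]):

* §2 conjugation `barCM ↦ (· + 1)` (`typeMap_barCM`), the abstract flip at a translate `t` `↦ (· + δ (θ t).2)` (`typeMap_oflipCM`),
  hence for the reads of `CorCM/CM/LefschetzChar1.lean`: `pullType (bar Θ) σ ↦ + 1`, `pullType (flip ρ Θ) σ ↦ + δ (θ (translate σ ρ)).2`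
  (`typeMap_pullType_bar`, `typeMap_pullType_flip`); the places of `F` are the `A`-coordinates: `t′ ∈ {t, c t} ↔ (θ t′).2 = (θ t).2`
  (`mem_orb_iff_snd_eq`), so the two places of a face read two DISTINCT elements of `A` (`snd_ne_of_face`);
* §3 change of base embedding `σ₀ ↦ Q σ₀` is b09's twist `tw (θ Q)` on types and the shift `· − (θ Q).2` on places
  (`typeMap_pullType_baseChange`, `snd_translate_baseChange`); the four corners of a tree face `(Φ; π, π′)` read at `σ` are
  `φ, φ + 1 + δ i, φ + 1 + δ j, φ + δ i + δ j` — b09's corner convention of `faceVec` (`typeMap_corner`).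

The sequel `CorCM/FaceCensusOddSliceTransport.lean` adds the `ℤ`-linear transport `ℤ^{Ty A} → ℤ[CMF (GalT F) conjT]`, `e_φ ↦ [typeOf φ]`
(b09's `pairVec φ ↦ pairRel`, `faceVec φ i j ↦ weightRel f.corner (fun _ ↦ {σ})` for any tree face `f` reading `(φ; i, j)` at `σ`,
`transl g ↦` change of base embedding), the non-vacuity of the reads (`faceOfG` of `CorCM/CM/LefschetzChar2.lean`), the datum from
`Aut(F)`, and turns any generation statement `hodge A ≤ pairs A ⊔ ℤ[G]·faceVec(S)` of b09's model into the INT2-GEN binder `hgen` —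
with no Cayley table, no bitmask and no certificate.

References: [cite: Pohlmann1968, Thm. 1]; [cite: Milne1999LefschetzClasses, Thm. 3.2]; [cite: Shimura1998, §8.1 (p. 62)].
-/

noncomputable section

open NumberField NumberField.ComplexEmbedding
open scoped symmDiff

namespace Summit.HodgeConjecture.CorCM.FaceCensus.OddSlice

open Literature.AlgebraicGeometry.Motives (CMType)
open Literature.NumberTheory.ComplexMultiplication.CMTypeOps
open Summit.HodgeConjecture.CorCM.Prior.AllgGroup.RfwfAllgGroup
open Summit.HodgeConjecture.CorCM.Census.OddSliceFacesModel
open Summit.HodgeConjecture.CorCM.Census.OddSliceFacesSquares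

variable {F : Type} [Field F] [NumberField F]
variable {A : Type} [AddCommGroup A] [Fintype A] [DecidableEq A]
variable (θ : GalT F ≃ ZMod 2 × A)

/-! ## §1 The dictionary datum and the bijection `CMF (GalT F) conjT ≃ Ty A` -/

/-- **The label of an abstract CM type**: `typeMap θ Ψ : A → ℤ/2` takes the value `0` at `y` iff `θ⁻¹(0, y) ∈ Ψ`, so that `Ψ` is the
graph `{θ⁻¹(φ y, y)}` of `φ = typeMap θ Ψ` (`mem_iff_typeMap`). [folklore] -/
def typeMap (Ψ : CMF (GalT F) conjT) : Ty A := fun y => if θ.symm (0, y) ∈ Ψ.1 then 0 else 1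

omit [Fintype A] [DecidableEq A] in
/-- `θ 1 = 0`. [folklore] -/
theorem theta_one (hθ : ∀ P Q : GalT F, θ (P * Q) = θ P + θ Q) : θ 1 = 0 := by
  have h := hθ 1 1
  rw [mul_one] at h
  exact left_eq_add.mp h

omit [Fintype A] [DecidableEq A] in
/-- `θ P⁻¹ = −θ P`. [folklore] -/
theorem theta_inv (hθ : ∀ P Q : GalT F, θ (P * Q) = θ P + θ Q) (P : GalT F) : θ P⁻¹ = -θ P := by
  have h := hθ P P⁻¹
  rw [mul_inv_cancel, theta_one θ hθ] at h
  exact (neg_eq_of_add_eq_zero_right h.symm).symm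

omit [Fintype A] [DecidableEq A] in
/-- `θ⁻¹` is additive-to-multiplicative. [folklore] -/
theorem symm_add (hθ : ∀ P Q : GalT F, θ (P * Q) = θ P + θ Q) (a b : ZMod 2 × A) :
    θ.symm (a + b) = θ.symm a * θ.symm b := by
  apply θ.injective
  rw [hθ, θ.apply_symm_apply, θ.apply_symm_apply, θ.apply_symm_apply]

omit [Fintype A] [DecidableEq A] in
/-- Complex conjugation shifts the `ℤ/2`-coordinate: `θ (c P) = θ P + (1, 0)`. [folklore] -/
theorem theta_conjT_mul (hθ : ∀ P Q : GalT F, θ (P * Q) = θ P + θ Q) (hc : θ conjT = (1, 0)) (P : GalT F) :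
    θ (conjT * P) = θ P + (1, 0) := by
  rw [hθ, hc, add_comm]

omit [Fintype A] [DecidableEq A] in
/-- … coordinate by coordinate. [folklore] -/
theorem theta_conjT_mul_fst (hθ : ∀ P Q : GalT F, θ (P * Q) = θ P + θ Q) (hc : θ conjT = (1, 0)) (P : GalT F) :
    (θ (conjT * P)).1 = (θ P).1 + 1 ∧ (θ (conjT * P)).2 = (θ P).2 := by
  rw [theta_conjT_mul θ hθ hc]
  exact ⟨rfl, by simp⟩

omit [Fintype A] [DecidableEq A] in
/-- `θ⁻¹(1, y) = c · θ⁻¹(0, y)`. [folklore] -/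
theorem symm_one_eq (hθ : ∀ P Q : GalT F, θ (P * Q) = θ P + θ Q) (hc : θ conjT = (1, 0)) (y : A) :
    θ.symm (1, y) = conjT * θ.symm (0, y) := by
  apply θ.injective
  rw [θ.apply_symm_apply, theta_conjT_mul θ hθ hc, θ.apply_symm_apply, Prod.mk_add_mk, zero_add, add_zero]

omit [Fintype A] [DecidableEq A] in
/-- **Membership through the dictionary**: `P ∈ Ψ ↔ (typeMap θ Ψ) (θ P).2 = (θ P).1` — `Ψ` is the graph of its label. [folklore] -/
theorem mem_iff_typeMap (hθ : ∀ P Q : GalT F, θ (P * Q) = θ P + θ Q) (hc : θ conjT = (1, 0))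
    (Ψ : CMF (GalT F) conjT) (P : GalT F) : P ∈ Ψ.1 ↔ typeMap θ Ψ (θ P).2 = (θ P).1 := by
  have h01 : ∀ u : ZMod 2, u = 0 ∨ u = 1 := by decide
  have hP : P = θ.symm ((θ P).1, (θ P).2) := by rw [Prod.mk.eta, θ.symm_apply_apply]
  unfold typeMap
  rcases h01 (θ P).1 with h0 | h1
  · rw [h0]
    rw [h0] at hP
    by_cases hm : θ.symm (0, (θ P).2) ∈ Ψ.1
    · rw [if_pos hm]
      exact ⟨fun _ => rfl, fun _ => hP ▸ hm⟩
    · rw [if_neg hm]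
      exact ⟨fun h => absurd (hP ▸ h) hm, fun h => absurd h (by decide)⟩
  · rw [h1]
    rw [h1, symm_one_eq θ hθ hc] at hP
    have key : P ∈ Ψ.1 ↔ θ.symm (0, (θ P).2) ∉ Ψ.1 := by
      have h2 := Ψ.2 (θ.symm (0, (θ P).2))
      rw [← hP] at h2
      rw [h2, not_not]
    rw [key]
    by_cases hm : θ.symm (0, (θ P).2) ∈ Ψ.1
    · rw [if_pos hm]
      exact ⟨fun h => absurd hm h, fun h => absurd h (by decide)⟩
    · rw [if_neg hm]
      exact ⟨fun _ => rfl, fun _ => hm⟩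

/-- **The abstract CM type of a label**: the graph `{P : (θ P).1 = φ (θ P).2}` of `φ : A → ℤ/2` (a CM type: `c` shifts the first
coordinate). [folklore] -/
def typeOf (hθ : ∀ P Q : GalT F, θ (P * Q) = θ P + θ Q) (hc : θ conjT = (1, 0)) (φ : Ty A) : CMF (GalT F) conjT :=
  ⟨Finset.univ.filter (fun P : GalT F => (θ P).1 = φ (θ P).2), by
    intro P
    simp only [Finset.mem_filter, Finset.mem_univ, true_and]
    rw [(theta_conjT_mul_fst θ hθ hc P).1, (theta_conjT_mul_fst θ hθ hc P).2]
    have key : ∀ u v : ZMod 2, u = v ↔ ¬ (u + 1 = v) := by decide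
    exact key _ _⟩

omit [Fintype A] [DecidableEq A] in
/-- Membership in `typeOf φ`. [folklore] -/
@[simp] theorem mem_typeOf (hθ : ∀ P Q : GalT F, θ (P * Q) = θ P + θ Q) (hc : θ conjT = (1, 0)) (φ : Ty A) (P : GalT F) :
    P ∈ (typeOf θ hθ hc φ).1 ↔ (θ P).1 = φ (θ P).2 := by
  simp [typeOf]

omit [Fintype A] [DecidableEq A] in
/-- The label of `typeOf φ` is `φ`. [folklore] -/
theorem typeMap_typeOf (hθ : ∀ P Q : GalT F, θ (P * Q) = θ P + θ Q) (hc : θ conjT = (1, 0)) (φ : Ty A) :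
    typeMap θ (typeOf θ hθ hc φ) = φ := by
  funext y
  unfold typeMap
  have hm : θ.symm (0, y) ∈ (typeOf θ hθ hc φ).1 ↔ (0 : ZMod 2) = φ y := by
    rw [mem_typeOf, θ.apply_symm_apply]
  have h01 : ∀ u : ZMod 2, u = 0 ∨ u = 1 := by decide
  by_cases h : θ.symm (0, y) ∈ (typeOf θ hθ hc φ).1
  · rw [if_pos h]; exact hm.mp h
  · rw [if_neg h]
    rcases h01 (φ y) with h0 | h1
    · exact absurd (hm.mpr h0.symm) h
    · exact h1.symm

omit [Fintype A] [DecidableEq A] in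
/-- The type of the label of `Ψ` is `Ψ`. [folklore] -/
theorem typeOf_typeMap (hθ : ∀ P Q : GalT F, θ (P * Q) = θ P + θ Q) (hc : θ conjT = (1, 0)) (Ψ : CMF (GalT F) conjT) :
    typeOf θ hθ hc (typeMap θ Ψ) = Ψ := by
  apply Subtype.ext
  ext P
  rw [mem_typeOf, eq_comm]
  exact (mem_iff_typeMap θ hθ hc Ψ P).symm

/-- **The dictionary is a bijection** `Ty A ≃ CMF (GalT F) conjT`. [folklore] -/
def typeEquiv (hθ : ∀ P Q : GalT F, θ (P * Q) = θ P + θ Q) (hc : θ conjT = (1, 0)) : Ty A ≃ CMF (GalT F) conjT where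
  toFun := typeOf θ hθ hc
  invFun := typeMap θ
  left_inv := typeMap_typeOf θ hθ hc
  right_inv := typeOf_typeMap θ hθ hc

omit [Fintype A] [DecidableEq A] in
/-- Two abstract CM types with the same label are equal. [folklore] -/
theorem typeMap_injective (hθ : ∀ P Q : GalT F, θ (P * Q) = θ P + θ Q) (hc : θ conjT = (1, 0)) :
    Function.Injective (typeMap (A := A) θ) :=
  (typeEquiv θ hθ hc).symm.injective

/-! ## §2 Conjugation, flips, reads and places through the dictionary -/

omit [AddCommGroup A] [Fintype A] [DecidableEq A] in
/-- **Conjugation**: `typeMap (barCM Ψ) = typeMap Ψ + 1`. [folklore] -/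
theorem typeMap_barCM (Ψ : CMF (GalT F) conjT) : typeMap θ (barCM Ψ) = typeMap θ Ψ + 1 := by
  funext y
  simp only [typeMap, mem_barCM, Pi.add_apply, Pi.one_apply]
  by_cases h : θ.symm (0, y) ∈ Ψ.1
  · rw [if_neg (not_not.mpr h), if_pos h]; decide
  · rw [if_pos h, if_neg h]; decide

omit [Fintype A] [DecidableEq A] in
/-- `typeOf (φ + 1) = barCM (typeOf φ)`. [folklore] -/
theorem typeOf_add_one (hθ : ∀ P Q : GalT F, θ (P * Q) = θ P + θ Q) (hc : θ conjT = (1, 0)) (φ : Ty A) :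
    typeOf θ hθ hc (φ + 1) = barCM (typeOf θ hθ hc φ) := by
  apply typeMap_injective θ hθ hc
  rw [typeMap_typeOf, typeMap_barCM, typeMap_typeOf]

omit [Fintype A] [DecidableEq A] in
/-- **Places are the `A`-coordinates**: `θ⁻¹(0, y)` lies over the place `{t, c t}` iff `y = (θ t).2`. [folklore] -/
theorem symm_mem_orb_iff (hθ : ∀ P Q : GalT F, θ (P * Q) = θ P + θ Q) (hc : θ conjT = (1, 0)) (t : GalT F) (y : A) :
    θ.symm (0, y) ∈ orb conjT t ↔ y = (θ t).2 := by
  rw [mem_orb]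
  have h01 : ∀ u : ZMod 2, u = 0 ∨ u = 1 := by decide
  constructor
  · rintro (h | h)
    · have e := congrArg (fun P => (θ P).2) h
      simp only [θ.apply_symm_apply] at e
      exact e
    · have e := congrArg (fun P => (θ P).2) h
      simp only [θ.apply_symm_apply, (theta_conjT_mul_fst θ hθ hc t).2] at e
      exact e
  · intro hy
    rcases h01 (θ t).1 with h0 | h1
    · left
      apply θ.injective
      rw [θ.apply_symm_apply, hy, ← h0, Prod.mk.eta]
    · right
      apply θ.injective
      rw [θ.apply_symm_apply, theta_conjT_mul θ hθ hc, hy]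
      ext
      · simp only [Prod.fst_add, h1]; decide
      · simp

omit [Fintype A] [DecidableEq A] in
/-- **Places are the `A`-coordinates**: `t′ ∈ {t, c t} ↔ (θ t′).2 = (θ t).2`. [folklore] -/
theorem mem_orb_iff_snd_eq (hθ : ∀ P Q : GalT F, θ (P * Q) = θ P + θ Q) (hc : θ conjT = (1, 0)) (t t' : GalT F) :
    t' ∈ orb conjT t ↔ (θ t').2 = (θ t).2 := by
  have h01 : ∀ u : ZMod 2, u = 0 ∨ u = 1 := by decide
  constructor
  · intro h
    rw [mem_orb] at h
    rcases h with rfl | rfl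
    · rfl
    · exact (theta_conjT_mul_fst θ hθ hc t).2
  · intro h
    rcases h01 (θ t').1 with h0 | h1
    · have e : t' = θ.symm (0, (θ t).2) := by
        apply θ.injective; rw [θ.apply_symm_apply, ← h, ← h0, Prod.mk.eta]
      rw [e]
      exact (symm_mem_orb_iff θ hθ hc t _).mpr rfl
    · have e : t' = conjT * θ.symm (0, (θ t).2) := by
        rw [← symm_one_eq θ hθ hc]
        apply θ.injective; rw [θ.apply_symm_apply, ← h, ← h1, Prod.mk.eta]
      rw [e]
      exact cmul_mem_orb conjT conjT_mul_self ((symm_mem_orb_iff θ hθ hc t _).mpr rfl)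

omit [Fintype A] in
/-- **The abstract flip** at the translate `t` adds the unit type at the place `(θ t).2`:
`typeMap (Ψ^{(t)}) = typeMap Ψ + δ (θ t).2`. [folklore] -/
theorem typeMap_oflipCM (hθ : ∀ P Q : GalT F, θ (P * Q) = θ P + θ Q) (hc : θ conjT = (1, 0)) (t : GalT F)
    (Ψ : CMF (GalT F) conjT) :
    typeMap θ (oflipCM conjT conjT_mul_self t Ψ) = typeMap θ Ψ + δ A (θ t).2 := by
  funext y
  simp only [typeMap, Pi.add_apply, delta_apply]
  change (if θ.symm (0, y) ∈ Ψ.1 ∆ orb conjT t then (0 : ZMod 2) else 1) = _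
  have hsd : θ.symm (0, y) ∈ Ψ.1 ∆ orb conjT t ↔
      θ.symm (0, y) ∈ Ψ.1 ∧ θ.symm (0, y) ∉ orb conjT t ∨ θ.symm (0, y) ∈ orb conjT t ∧ θ.symm (0, y) ∉ Ψ.1 :=
    Finset.mem_symmDiff
  by_cases hy : y = (θ t).2
  · have ho : θ.symm (0, y) ∈ orb conjT t := (symm_mem_orb_iff θ hθ hc t y).mpr hy
    rw [if_pos hy]
    by_cases hm : θ.symm (0, y) ∈ Ψ.1
    · have hn : θ.symm (0, y) ∉ Ψ.1 ∆ orb conjT t := fun h => by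
        rcases hsd.mp h with h | h
        · exact h.2 ho
        · exact h.2 hm
      rw [if_pos hm, if_neg hn]; decide
    · rw [if_neg hm, if_pos (hsd.mpr (Or.inr ⟨ho, hm⟩))]; decide
  · have ho : θ.symm (0, y) ∉ orb conjT t := fun h => hy ((symm_mem_orb_iff θ hθ hc t y).mp h)
    rw [if_neg hy, add_zero]
    by_cases hm : θ.symm (0, y) ∈ Ψ.1
    · rw [if_pos hm, if_pos (hsd.mpr (Or.inl ⟨hm, ho⟩))]
    · have hn : θ.symm (0, y) ∉ Ψ.1 ∆ orb conjT t := fun h => by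
        rcases hsd.mp h with h | h
        · exact hm h.1
        · exact ho h.1
      rw [if_neg hm, if_neg hn]

omit [AddCommGroup A] [Fintype A] [DecidableEq A] in
/-- **Read of the conjugate type**: `typeMap (pullType Θ̄ σ) = typeMap (pullType Θ σ) + 1`. [folklore] -/
theorem typeMap_pullType_bar (Θ : CMType F) (σ : F →+* ℂ) :
    typeMap θ (pullType (bar Θ) σ) = typeMap θ (pullType Θ σ) + 1 := by
  rw [pullType_bar, typeMap_barCM]

omit [Fintype A] in
/-- **Read of a flipped type**: `typeMap (pullType Θ^{(ρ)} σ) = typeMap (pullType Θ σ) + δ (θ (translate σ ρ)).2`. [folklore] -/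
theorem typeMap_pullType_flip [IsGalois ℚ F] (hθ : ∀ P Q : GalT F, θ (P * Q) = θ P + θ Q) (hc : θ conjT = (1, 0))
    (Θ : CMType F) (σ ρ : F →+* ℂ) :
    typeMap θ (pullType (flip ρ Θ) σ) = typeMap θ (pullType Θ σ) + δ A (θ (translate σ ρ)).2 := by
  rw [pullType_flip_translate, typeMap_oflipCM θ hθ hc]

omit [Fintype A] [DecidableEq A] in
/-- **The two places of a face read two distinct elements of `A`.** [folklore] -/
theorem snd_ne_of_face [IsGalois ℚ F] (hθ : ∀ P Q : GalT F, θ (P * Q) = θ P + θ Q) (hc : θ conjT = (1, 0))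
    (f : Face F) (σ : F →+* ℂ) : (θ (translate σ f.p)).2 ≠ (θ (translate σ f.p')).2 := fun h =>
  Face.translate_notMem_orb f σ ((mem_orb_iff_snd_eq θ hθ hc _ _).mpr h.symm)

omit [Fintype A] in
/-- **The four corner reads of a face through the dictionary**: for `f = (Φ; π, π′)` read at `σ` with `φ = typeMap (pullType Φ σ)`,
`i = (θ (translate σ π)).2`, `j = (θ (translate σ π′)).2`, the corners `Φ, Φ̄^{(π)}, Φ̄^{(π′)}, Φ^{(ππ′)}` read
`φ, φ + 1 + δ i, φ + 1 + δ j, φ + δ i + δ j` — b09's corner convention of `faceVec` (`Census/OddSliceFacesSquares.lean`). [folklore] -/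
theorem typeMap_corner [IsGalois ℚ F] (hθ : ∀ P Q : GalT F, θ (P * Q) = θ P + θ Q) (hc : θ conjT = (1, 0))
    (f : Face F) (σ : F →+* ℂ) :
    typeMap θ (pullType (f.corner 0) σ) = typeMap θ (pullType f.Φ σ) ∧
    typeMap θ (pullType (f.corner 1) σ) =
      typeMap θ (pullType f.Φ σ) + 1 + δ A (θ (translate σ f.p)).2 ∧
    typeMap θ (pullType (f.corner 2) σ) =
      typeMap θ (pullType f.Φ σ) + 1 + δ A (θ (translate σ f.p')).2 ∧
    typeMap θ (pullType (f.corner 3) σ) =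
      typeMap θ (pullType f.Φ σ) + δ A (θ (translate σ f.p)).2 + δ A (θ (translate σ f.p')).2 := by
  refine ⟨rfl, ?_, ?_, ?_⟩
  · show typeMap θ (pullType (flip f.p (bar f.Φ)) σ) = _
    rw [typeMap_pullType_flip θ hθ hc, typeMap_pullType_bar]
  · show typeMap θ (pullType (flip f.p' (bar f.Φ)) σ) = _
    rw [typeMap_pullType_flip θ hθ hc, typeMap_pullType_bar]
  · show typeMap θ (pullType (flip f.p' (flip f.p f.Φ)) σ) = _
    rw [typeMap_pullType_flip θ hθ hc, typeMap_pullType_flip θ hθ hc]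

/-! ## §3 Change of base embedding = b09's twist -/

omit [Fintype A] [DecidableEq A] in
/-- **Base change on types**: reading `Θ` at `Q σ₀` instead of `σ₀` twists the label by `θ Q`:
`typeMap (pullType Θ (Q σ₀)) = tw (θ Q) (typeMap (pullType Θ σ₀))`. [folklore] -/
theorem typeMap_pullType_baseChange [IsGalois ℚ F] (hθ : ∀ P Q : GalT F, θ (P * Q) = θ P + θ Q) (hc : θ conjT = (1, 0))
    (Θ : CMType F) (σ₀ : F →+* ℂ) (Q : GalT F) :
    typeMap θ (pullType Θ (Q.1 σ₀)) = tw A (θ Q) (typeMap θ (pullType Θ σ₀)) := by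
  funext y
  have hm : θ.symm (0, y) ∈ (pullType Θ (Q.1 σ₀)).1 ↔ θ.symm (0, y) * Q ∈ (pullType Θ σ₀).1 := by
    rw [mem_pullType, mem_pullType, GalT.mul_apply]
  have hθm : θ (θ.symm (0, y) * Q) = ((θ Q).1, y + (θ Q).2) := by
    rw [hθ, θ.apply_symm_apply]; ext <;> simp
  have key : ∀ u a : ZMod 2, (if u = a then (0 : ZMod 2) else 1) = u + a := by decide
  simp only [tw]
  conv_lhs => rw [typeMap]
  simp only [hm, mem_iff_typeMap θ hθ hc, hθm]
  exact key _ _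

omit [Fintype A] [DecidableEq A] in
/-- **Base change on places**: `(θ (translate (Q σ₀) ρ)).2 = (θ (translate σ₀ ρ)).2 − (θ Q).2`. [folklore] -/
theorem snd_translate_baseChange [IsGalois ℚ F] (hθ : ∀ P Q : GalT F, θ (P * Q) = θ P + θ Q)
    (σ₀ ρ : F →+* ℂ) (Q : GalT F) :
    (θ (translate (Q.1 σ₀) ρ)).2 = (θ (translate σ₀ ρ)).2 - (θ Q).2 := by
  rw [translate_baseChange, hθ, theta_inv θ hθ, Prod.snd_add, Prod.snd_neg, sub_eq_add_neg]

omit [Fintype A] [DecidableEq A] in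
/-- **A face read at `σ₀` as `(φ; i, j)` reads at `Q σ₀` as `(tw (θ Q) φ; i − (θ Q).2, j − (θ Q).2)`.** [folklore] -/
theorem reads_baseChange [IsGalois ℚ F] (hθ : ∀ P Q : GalT F, θ (P * Q) = θ P + θ Q) (hc : θ conjT = (1, 0))
    (f : Face F) (σ₀ : F →+* ℂ) (Q : GalT F) {φ : Ty A} {i j : A}
    (hΦ : typeMap θ (pullType f.Φ σ₀) = φ) (hp : (θ (translate σ₀ f.p)).2 = i) (hq : (θ (translate σ₀ f.p')).2 = j) :
    typeMap θ (pullType f.Φ (Q.1 σ₀)) = tw A (θ Q) φ ∧ (θ (translate (Q.1 σ₀) f.p)).2 = i - (θ Q).2 ∧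
      (θ (translate (Q.1 σ₀) f.p')).2 = j - (θ Q).2 := by
  rw [typeMap_pullType_baseChange θ hθ hc, hΦ, snd_translate_baseChange θ hθ, hp, snd_translate_baseChange θ hθ, hq]
  exact ⟨rfl, rfl, rfl⟩

end Summit.HodgeConjecture.CorCM.FaceCensus.OddSlice

end
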